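import Summits.AtomisticToContinuum.HydrodynamicLimit.Theorems.LambertianContactSwapLambertianEulerMarkedKorolyuk
import HarnessLib

/-!
# The marked Korolyuk inequality with configuration marks
# (`LambertianContactSwap.LambertianEuler`, stmt-AtomisticToContinuum-11854, line `Sketch`; lead c10,
# piece W6 `ConfigMarkedKorolyuk`: registered stub `configMarkedContacts_le_meshSum`)

Pathwise (deterministic) step of the equilibrium mean of the "marked" Lambertian collisions of
lead c10.  Notation as in `…LambertianEulerMarkedKorolyuk`: for the Lambertian hard-sphere recursion
`t_k = lambertInstant`, `K_s = lambertCount`, `z_k = lambertStateAfter`, `τ_k = freeExitTime z_k`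
(`t_{k+1} = t_k + τ_k`), `Λ_s = lambertFlow`, and `z_k♭ = S_{τ_k} z_k` is the exit (pre-collisional)
configuration of the `k`-th free flight.  In `…MarkedKorolyuk.markedContacts_le_meshSum` the mark
`wt q y` of a pair `q` depends on the configuration `y` only through its velocities, and is read on
`z_m`.  Here the mark is read on the whole EXIT CONFIGURATION `z_m♭` (positions too), and a second
nonnegative mark `wt'` is read at the mesh configurations; the two are related by the TRANSPORT
hypothesis `wt q (S_u y) ≤ wt' q y` for `y` in the hard-sphere domain and `0 ≤ u ≤ u₀`.

* `configMarkedContacts_le_meshSum` (the registered stub, torus `𝕋³`, diameter `hsDiameter σ N`) and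
  its geometry-free form `configMarkedContacts_le_meshSum_of_lipschitz`: on a simple (`τ_k > 0`),
  non-accumulating path whose exit configurations are simple incoming, for a window `(a', a' + h]`
  and the mesh `h' = h/(n+1)`, `s_j = a' + j h'`, for all large `n`,
  `Σ_{m < K_{a'+h}, a' < t_{m+1}} Σ_q 𝟙{q ∈ incomingPairs z_m♭} wt q z_m♭
    ≤ Σ_{j ≤ n} Σ_q 𝟙{q.1 ≠ q.2, ε ≤ d_q(Λ_{s_j}) ≤ ε + h' ‖Δv_q(Λ_{s_j})‖} wt' q Λ_{s_j}`.
  The proof is that of `…MarkedKorolyuk.markedContacts_le_meshSum_of_lipschitz`: once `h'` is below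
  the minimal gap `min_{m<K} τ_m` AND below `u₀`, the counted instants `t_{m+1} ∈ (a', a'+h]` lie in
  pairwise distinct mesh intervals `(s_{j(m)}, s_{j(m)} + h']` with `t_m ≤ s_{j(m)}`; the mesh
  configuration `Λ_{s_{j(m)}}` lies in the domain and flows freely in time
  `δ = t_{m+1} - s_{j(m)} ∈ [0, h'] ⊆ [0, u₀]` EXACTLY to `z_m♭` (`lambertFlow_segment_data`), so the
  charge `wt p_m z_m♭` of the unique incoming pair `p_m` (`incomingPairs z_m♭ = {p_m}`) is at most
  `wt' p_m Λ_{s_{j(m)}}` (transport), one nonnegative term of the mesh sum since `p_m` is shell-close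
  at the mesh time by the Lipschitz bound of the separation along free flight
  (`sum_indicator_le_sum_configMarks`; on the torus
  `…FirstCollision.norm_sepVec_le_norm_sepVec_freeFlight_add`).  Summing over the injection
  `m ↦ j(m)` (`sum_ite_le_sum_sum_of_injOn`) gives the claim.

References: Daley–Vere-Jones, *An Introduction to the Theory of Point Processes* I, Prop. 3.3.I
(Korolyuk's theorem) and §3.3; C. Cercignani, R. Illner, M. Pulvirenti, *The Mathematical Theory of
Dilute Gases* (1994), App. 4.A (collision-by-collision construction).  All statements [folklore].
-/

noncomputable section

namespace Summit.AtomisticToContinuum.HydrodynamicLimit.Theorems.LambertianContactSwapLambertianEulerConfigMarkedKorolyuk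

open scoped BigOperators Topology ENNReal
open MeasureTheory Filter Set
open Literature.MathematicalPhysics.KineticTheory
open Literature.Analysis.FluidPDE Literature.Analysis.FluidPDE.Alexander
open Summit.AtomisticToContinuum.HydrodynamicLimit.Theorems.LambertianContactSwapLambertianEulerMarkedKorolyuk

/-! ## Pathwise: one counted contact charged to its mesh time, and the inequality -/

section Pathwise

variable {d : Type*} [Fintype d] {X : Type*} {N : ℕ} {G : Geometry d X} {ε : ℝ}
  {ξs : ℕ → EuclideanSpace ℝ d} {z : Config N d X}

/-- **One contact charged to a mesh time (configuration marks).**  If the separation is Lipschitz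
along free flight, the incoming pairs are exactly `{p}` at the configuration `w = S_δ y` reached from
a domain configuration `y` by a free flight of duration `0 ≤ δ ≤ h' ≤ u₀`, and the mark `wt` read
after a free flight of duration `≤ u₀` from the domain is dominated by the mark `wt' ≥ 0` read before
it, then the `p`-mark `wt p w` is at most the sum of the marks `wt'` of `y` over its shell-close pairs
`{q.1 ≠ q.2, ε ≤ d_q(y) ≤ ε + h' ‖Δv_q(y)‖}` (the pair `p` is one of them). [folklore] -/
theorem sum_indicator_le_sum_configMarks
    (hLip : ∀ (y : Config N d X) (s : ℝ) (i j : Fin N), ‖G.sepVec (y i).1 (y j).1‖ ≤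
      ‖G.sepVec ((freeFlight G s y) i).1 ((freeFlight G s y) j).1‖ + |s| * ‖(y i).2 - (y j).2‖)
    (wt wt' : Fin N × Fin N → Config N d X → ℝ) (hwt0 : ∀ q y, 0 ≤ wt' q y) {u₀ : ℝ}
    (htrans : ∀ (q : Fin N × Fin N) (y : Config N d X) (u : ℝ), y ∈ hardSphereDomain G N ε →
      0 ≤ u → u ≤ u₀ → wt q (freeFlight G u y) ≤ wt' q y)
    {S : Set (Fin N × Fin N)} {p : Fin N × Fin N} {y w : Config N d X} {δ h' : ℝ}
    (hS : S = {p}) (hw : freeFlight G δ y = w) (hp : IsSimpleIncomingWith G ε w p) (hδ0 : 0 ≤ δ)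
    (hδ : δ ≤ h') (hh' : h' ≤ u₀) (hyD : y ∈ hardSphereDomain G N ε) :
    ∑ q, S.indicator (fun q' => wt q' w) q ≤
      ∑ q : Fin N × Fin N, (if q.1 ≠ q.2 ∧ ε ≤ ‖G.sepVec (y q.1).1 (y q.2).1‖ ∧
          ‖G.sepVec (y q.1).1 (y q.2).1‖ ≤ ε + h' * ‖(y q.1).2 - (y q.2).2‖ then wt' q y else 0) := by
  subst hw
  -- the left-hand side is the `p`-mark of the exit configuration
  have hsum : ∑ q, S.indicator (fun q' => wt q' (freeFlight G δ y)) q = wt p (freeFlight G δ y) := by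
    rw [hS, Finset.sum_eq_single p]
    · exact Set.indicator_of_mem (Set.mem_singleton p) _
    · exact fun q _ hq => Set.indicator_of_notMem (fun h => hq (Set.mem_singleton_iff.1 h)) _
    · exact fun h => absurd (Finset.mem_univ p) h
  -- the pair `p` is shell-close in `y`: contact after the flight, Lipschitz bound, domain
  have hcontact : ‖G.sepVec ((freeFlight G δ y) p.1).1 ((freeFlight G δ y) p.2).1‖ = ε :=
    hp.mem_contactSet.2
  have hupper : ‖G.sepVec (y p.1).1 (y p.2).1‖ ≤ ε + h' * ‖(y p.1).2 - (y p.2).2‖ := by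
    have hL := hLip y δ p.1 p.2
    rw [hcontact, abs_of_nonneg hδ0] at hL
    have hmul : δ * ‖(y p.1).2 - (y p.2).2‖ ≤ h' * ‖(y p.1).2 - (y p.2).2‖ :=
      mul_le_mul_of_nonneg_right hδ (norm_nonneg _)
    linarith
  have hcond : p.1 ≠ p.2 ∧ ε ≤ ‖G.sepVec (y p.1).1 (y p.2).1‖ ∧
      ‖G.sepVec (y p.1).1 (y p.2).1‖ ≤ ε + h' * ‖(y p.1).2 - (y p.2).2‖ :=
    ⟨hp.ne, hyD p.1 p.2 hp.ne, hupper⟩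
  -- transport the mark back along the flight; one nonnegative term of the right-hand side
  rw [hsum]
  refine (htrans p y δ hyD hδ0 (hδ.trans hh')).trans ?_
  refine le_trans ?_ (Finset.single_le_sum (fun q _ => ?_) (Finset.mem_univ p))
  · rw [if_pos hcond]
  · split_ifs
    · exact hwt0 _ _
    · exact le_rfl

/-- **The marked Korolyuk inequality with configuration marks, pathwise, for a separation that is
Lipschitz along free flight.**  On a simple (`τ_k > 0`), non-accumulating Lambertian path whose exit
configurations are simple incoming collision configurations, for two marks `wt`, `wt' ≥ 0` with
`wt q (S_u y) ≤ wt' q y` for `y` in the domain and `0 ≤ u ≤ u₀` (`u₀ > 0`), a window `(a', a'+h]`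
(`a' ≥ 0`, `h > 0`) and all large `n` (`h' = h/(n+1)`, `s_j = a' + j h'`): the sum over the counted
contacts `m < K_{a'+h}`, `a' < t_{m+1}`, of the marks `wt` of the incoming pairs of `z_m♭` read on
`z_m♭` is at most the mesh sum over `j ≤ n` and the shell-close pairs `q` of `Λ_{s_j}` (`q.1 ≠ q.2`,
`ε ≤ d_q ≤ ε + h' ‖Δv_q‖`) of the marks `wt'` of `Λ_{s_j}`. [folklore] -/
theorem configMarkedContacts_le_meshSum_of_lipschitz
    (hLip : ∀ (y : Config N d X) (s : ℝ) (i j : Fin N), ‖G.sepVec (y i).1 (y j).1‖ ≤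
      ‖G.sepVec ((freeFlight G s y) i).1 ((freeFlight G s y) j).1‖ + |s| * ‖(y i).2 - (y j).2‖)
    (hpos : ∀ k, 0 < freeExitTime G ε (lambertStateAfter G ε ξs z k))
    (hacc : ∀ T : ℝ, ∃ k, ENNReal.ofReal T < lambertInstant G ε ξs z k)
    (hsimple : ∀ k, freeExitTime G ε (lambertStateAfter G ε ξs z k) ≠ ∞ →
      IsSimpleIncoming G ε (freeFlight G (freeExitTime G ε (lambertStateAfter G ε ξs z k)).toReal
        (lambertStateAfter G ε ξs z k)))
    (wt wt' : Fin N × Fin N → Config N d X → ℝ) (hwt0 : ∀ q y, 0 ≤ wt' q y) {u₀ : ℝ} (hu₀ : 0 < u₀)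
    (htrans : ∀ (q : Fin N × Fin N) (y : Config N d X) (u : ℝ), y ∈ hardSphereDomain G N ε →
      0 ≤ u → u ≤ u₀ → wt q (freeFlight G u y) ≤ wt' q y)
    {a' h : ℝ} (ha' : 0 ≤ a') (hh : 0 < h) :
    ∀ᶠ n : ℕ in atTop,
      (∑ m ∈ Finset.range (lambertCount G ε ξs z (a' + h)),
          if a' < (lambertInstant G ε ξs z (m + 1)).toReal then
            ∑ q : Fin N × Fin N,
              (incomingPairs G ε (freeFlight G
                (freeExitTime G ε (lambertStateAfter G ε ξs z m)).toReal
                (lambertStateAfter G ε ξs z m))).indicator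
                (fun q' => wt q' (freeFlight G
                  (freeExitTime G ε (lambertStateAfter G ε ξs z m)).toReal
                  (lambertStateAfter G ε ξs z m))) q
          else 0) ≤
        ∑ j ∈ Finset.range (n + 1), ∑ q : Fin N × Fin N,
          (if q.1 ≠ q.2 ∧
              ε ≤ ‖G.sepVec (lambertFlow G ε ξs z (a' + (j : ℝ) * (h / ((n : ℝ) + 1))) q.1).1
                  (lambertFlow G ε ξs z (a' + (j : ℝ) * (h / ((n : ℝ) + 1))) q.2).1‖ ∧
              ‖G.sepVec (lambertFlow G ε ξs z (a' + (j : ℝ) * (h / ((n : ℝ) + 1))) q.1).1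
                  (lambertFlow G ε ξs z (a' + (j : ℝ) * (h / ((n : ℝ) + 1))) q.2).1‖ ≤
                ε + (h / ((n : ℝ) + 1)) *
                  ‖(lambertFlow G ε ξs z (a' + (j : ℝ) * (h / ((n : ℝ) + 1))) q.1).2 -
                    (lambertFlow G ε ξs z (a' + (j : ℝ) * (h / ((n : ℝ) + 1))) q.2).2‖
            then wt' q (lambertFlow G ε ξs z (a' + (j : ℝ) * (h / ((n : ℝ) + 1))))
            else 0) := by
  -- adapted from `…MarkedKorolyuk.markedContacts_le_meshSum_of_lipschitz`
  set K := lambertCount G ε ξs z (a' + h) with hK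
  set t : ℕ → ℝ≥0∞ := lambertInstant G ε ξs z with ht
  set τ : ℕ → ℝ≥0∞ := fun k => freeExitTime G ε (lambertStateAfter G ε ξs z k) with hτ
  -- nonnegativity of the right-hand side summands
  have hg0 : ∀ (P : Prop) [Decidable P] (x : ℝ), 0 ≤ x → 0 ≤ (if P then x else 0) := by
    intro P _ x hx
    split_ifs
    · exact hx
    · exact le_rfl
  rcases Nat.eq_zero_or_pos K with hK0 | hKpos
  · refine Eventually.of_forall fun n => ?_
    rw [hK0, Finset.range_zero, Finset.sum_empty]
    exact Finset.sum_nonneg fun j _ => Finset.sum_nonneg fun q _ => hg0 _ _ (hwt0 _ _)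
  -- the segment of `a' + h`: `t_K ≤ a' + h`, so the first `K + 1` instants and `K` gaps are finite
  have hah : 0 ≤ a' + h := by positivity
  obtain ⟨m₀, hm1, hm2⟩ := LRestart.exists_lambert_segment (hacc (a' + h)) le_rfl
  have hKm : K = m₀ := lambertCount_eq_of_segment hm1 hm2
  have htK : t K ≤ ENNReal.ofReal (a' + h) := by rw [hKm]; exact hm1
  have htop : ∀ k ≤ K, t k ≠ ∞ := fun k hk =>
    ne_top_of_le_ne_top ENNReal.ofReal_ne_top ((monotone_lambertInstant ξs z hk).trans htK)
  have hsucc : ∀ k, t (k + 1) = t k + τ k := fun k => lambertInstant_succ ξs z k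
  have hτtop : ∀ k < K, τ k ≠ ∞ := fun k hk => by
    have h1 := htop (k + 1) hk
    rw [hsucc] at h1
    exact (ENNReal.add_ne_top.1 h1).2
  have hgap : ∀ k < K, (t (k + 1)).toReal = (t k).toReal + (τ k).toReal := fun k hk => by
    rw [hsucc, ENNReal.toReal_add (htop k hk.le) (hτtop k hk)]
  -- the minimal gap `g > 0`
  obtain ⟨k₀, hk₀, hmin⟩ := (Finset.range K).exists_min_image (fun k => (τ k).toReal)
    ⟨0, Finset.mem_range.2 hKpos⟩
  have hk₀K : k₀ < K := Finset.mem_range.1 hk₀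
  set g := (τ k₀).toReal with hg
  have hgpos : 0 < g := ENNReal.toReal_pos (hpos k₀).ne' (hτtop k₀ hk₀K)
  have hming : ∀ k < K, g ≤ (τ k).toReal := fun k hk => hmin k (Finset.mem_range.2 hk)
  -- the counted instants lie in the window and are separated by at least `g`
  have htle : ∀ k < K, (t (k + 1)).toReal ≤ a' + h := fun k hk =>
    ENNReal.toReal_le_of_le_ofReal hah ((monotone_lambertInstant ξs z hk).trans htK)
  have hsep : ∀ k₁ k₂, k₁ < k₂ → k₂ < K → (t (k₁ + 1)).toReal + g ≤ (t (k₂ + 1)).toReal := by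
    intro k₁ k₂ h12 h2K
    calc (t (k₁ + 1)).toReal + g ≤ (t (k₁ + 1)).toReal + (τ (k₁ + 1)).toReal := by
          gcongr; exact hming (k₁ + 1) (by omega)
      _ = (t (k₁ + 1 + 1)).toReal := (hgap (k₁ + 1) (by omega)).symm
      _ ≤ (t (k₂ + 1)).toReal :=
        ENNReal.toReal_mono (htop (k₂ + 1) h2K) (monotone_lambertInstant ξs z (by omega))
  -- fine meshes: `h / (n + 1) < g` and `h / (n + 1) < u₀` eventually
  have hsmall : Tendsto (fun n : ℕ => h / ((n : ℝ) + 1)) atTop (𝓝 0) := by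
    have h1 : Tendsto (fun n : ℕ => h * (1 / ((n : ℝ) + 1))) atTop (𝓝 (h * 0)) :=
      tendsto_one_div_add_atTop_nhds_zero_nat.const_mul h
    rw [mul_zero] at h1
    exact h1.congr fun n => mul_one_div h _
  filter_upwards [hsmall.eventually_lt_const hgpos, hsmall.eventually_lt_const hu₀] with n hn hnu
  set h' := h / ((n : ℝ) + 1) with hh'
  have hn1 : (0 : ℝ) < (n : ℝ) + 1 := by positivity
  have hh'pos : 0 < h' := div_pos hh hn1
  have hhn : ((n + 1 : ℕ) : ℝ) * h' = h := by rw [hh']; push_cast; field_simp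
  -- the mesh interval `(a' + J k * h', a' + (J k + 1) * h']` of a counted instant `t_{k+1} ∈ (a', a'+h]`
  set J : ℕ → ℕ := fun k => ⌈((t (k + 1)).toReal - a') / h'⌉₊ - 1 with hJ
  have hcnt : ∀ k < K, a' < (t (k + 1)).toReal →
      J k < n + 1 ∧ a' + (J k : ℝ) * h' < (t (k + 1)).toReal ∧
        (t (k + 1)).toReal ≤ a' + (J k : ℝ) * h' + h' := by
    intro k hk hak
    have hx : 0 < ((t (k + 1)).toReal - a') / h' := div_pos (sub_pos.2 hak) hh'pos
    have hJ1 : J k + 1 = ⌈((t (k + 1)).toReal - a') / h'⌉₊ :=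
      Nat.sub_add_cancel (Nat.ceil_pos.2 hx)
    have hJcast : (J k : ℝ) + 1 = (⌈((t (k + 1)).toReal - a') / h'⌉₊ : ℝ) := by
      exact_mod_cast hJ1
    refine ⟨?_, ?_, ?_⟩
    · have hceil : ⌈((t (k + 1)).toReal - a') / h'⌉₊ ≤ n + 1 := by
        refine Nat.ceil_le.2 ((div_le_iff₀ hh'pos).2 ?_)
        rw [hhn]
        linarith [htle k hk]
      omega
    · have h1 : (⌈((t (k + 1)).toReal - a') / h'⌉₊ : ℝ) < ((t (k + 1)).toReal - a') / h' + 1 :=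
        Nat.ceil_lt_add_one hx.le
      rw [← hJcast] at h1
      have h2 : (J k : ℝ) < ((t (k + 1)).toReal - a') / h' := by linarith
      rw [lt_div_iff₀ hh'pos] at h2
      linarith
    · have h1 : ((t (k + 1)).toReal - a') / h' ≤ (⌈((t (k + 1)).toReal - a') / h'⌉₊ : ℝ) :=
        Nat.le_ceil _
      rw [← hJcast, div_le_iff₀ hh'pos] at h1
      linarith
  -- charge each counted contact to its mesh interval
  refine sum_ite_le_sum_sum_of_injOn J (fun j q => hg0 _ _ (hwt0 _ _))
    (fun m hm hcm => Finset.mem_range.2 (hcnt m (Finset.mem_range.1 hm) hcm).1)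
    (fun m₁ hm₁ hc₁ m₂ hm₂ hc₂ hJeq => ?_) (fun m hm hcm => ?_)
  · -- distinct counted instants lie in distinct mesh intervals (`h' < g`)
    have hm₁K := Finset.mem_range.1 hm₁
    have hm₂K := Finset.mem_range.1 hm₂
    by_contra hne
    rcases lt_or_gt_of_ne hne with hlt | hgt
    · have h1 := (hcnt m₁ hm₁K hc₁).2.1
      have h2 := (hcnt m₂ hm₂K hc₂).2.2
      have h3 := hsep m₁ m₂ hlt hm₂K
      rw [hJeq] at h1
      linarith
    · have h1 := (hcnt m₂ hm₂K hc₂).2.1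
      have h2 := (hcnt m₁ hm₁K hc₁).2.2
      have h3 := hsep m₂ m₁ hgt hm₁K
      rw [← hJeq] at h1
      linarith
  · -- a counted contact `m`: the segment of its mesh time, the unique incoming pair, the charge
    have hmK := Finset.mem_range.1 hm
    obtain ⟨-, hJlt, hJle⟩ := hcnt m hmK hcm
    have hs0 : 0 ≤ a' + (J m : ℝ) * h' := add_nonneg ha' (mul_nonneg (Nat.cast_nonneg _) hh'pos.le)
    have htm : (t m).toReal ≤ a' + (J m : ℝ) * h' := by
      have e1 := hgap m hmK
      have e2 := hming m hmK
      linarith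
    obtain ⟨-, hyD, hexit, -⟩ :=
      lambertFlow_segment_data hs0 (htop m hmK.le) (htop (m + 1) hmK) htm hJlt
    obtain ⟨p, hp⟩ := isSimpleIncoming_iff.1 (hsimple m (hτtop m hmK))
    exact sum_indicator_le_sum_configMarks hLip wt wt' hwt0 htrans hp.incomingPairs_eq hexit hp
      (sub_nonneg.2 hJlt.le) (by linarith) hnu.le hyD

end Pathwise

/-! ## The registered stub: the torus `𝕋³` at fixed reduced density -/

/-- **W6: the pathwise marked Korolyuk inequality with configuration marks** (registered stub
`configMarkedContacts_le_meshSum` of lead c10, line `Sketch`, crux stmt-AtomisticToContinuum-11854).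
On a simple, non-accumulating Lambertian path from the hard-sphere domain of `N + 1` spheres of
diameter `hsDiameter σ N` in `𝕋³` whose exit configurations are simple incoming, for two marks `wt`,
`wt' ≥ 0` with `wt q (S_u y) ≤ wt' q y` for `y` in the domain and `0 ≤ u ≤ u₀` (`u₀ > 0`), the sum
over the contacts of a window `(a', a'+h]` of the marks `wt` of the incoming pairs of the exit
configurations, read ON THE EXIT CONFIGURATIONS, is eventually (in the mesh `h' = h/(n+1)`) dominated
by the mesh sum of the marks `wt'` over the shell-close pairs `ε ≤ d_q ≤ ε + h' ‖Δv_q‖` read at the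
mesh times `a' + j h'` (`configMarkedContacts_le_meshSum_of_lipschitz` with the torus Lipschitz bound
`…FirstCollision.norm_sepVec_le_norm_sepVec_freeFlight_add`). [folklore] -/
theorem configMarkedContacts_le_meshSum :
    ∀ {σ : ℝ}, 0 < σ → σ < 2⁻¹ → ∀ (N : ℕ) (z : Config (N + 1) (Fin 3) T3) (ξs : ℕ → V3),
      z ∈ hardSphereDomain (Torus.geometry (Fin 3)) (N + 1) (hsDiameter σ N) →
      (∀ k : ℕ, 0 < freeExitTime (Torus.geometry (Fin 3)) (hsDiameter σ N)
          (lambertStateAfter (Torus.geometry (Fin 3)) (hsDiameter σ N) ξs z k)) →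
      (∀ T : ℝ, ∃ k, ENNReal.ofReal T < lambertInstant (Torus.geometry (Fin 3)) (hsDiameter σ N) ξs z k) →
      (∀ k : ℕ, freeExitTime (Torus.geometry (Fin 3)) (hsDiameter σ N)
            (lambertStateAfter (Torus.geometry (Fin 3)) (hsDiameter σ N) ξs z k) ≠ ⊤ →
          IsSimpleIncoming (Torus.geometry (Fin 3)) (hsDiameter σ N)
            (freeFlight (Torus.geometry (Fin 3))
              (freeExitTime (Torus.geometry (Fin 3)) (hsDiameter σ N)
                (lambertStateAfter (Torus.geometry (Fin 3)) (hsDiameter σ N) ξs z k)).toReal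
              (lambertStateAfter (Torus.geometry (Fin 3)) (hsDiameter σ N) ξs z k))) →
      ∀ (wt wt' : Fin (N + 1) × Fin (N + 1) → Config (N + 1) (Fin 3) T3 → ℝ), (∀ q y, 0 ≤ wt' q y) →
      ∀ u₀ : ℝ, 0 < u₀ →
        (∀ (q : Fin (N + 1) × Fin (N + 1)) (y : Config (N + 1) (Fin 3) T3) (u : ℝ),
            y ∈ hardSphereDomain (Torus.geometry (Fin 3)) (N + 1) (hsDiameter σ N) → 0 ≤ u → u ≤ u₀ →
            wt q (freeFlight (Torus.geometry (Fin 3)) u y) ≤ wt' q y) →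
        ∀ (a' h : ℝ), 0 ≤ a' → 0 < h →
          ∀ᶠ n : ℕ in Filter.atTop,
            (∑ m ∈ Finset.range (lambertCount (Torus.geometry (Fin 3)) (hsDiameter σ N) ξs z (a' + h)),
                if a' < (lambertInstant (Torus.geometry (Fin 3)) (hsDiameter σ N) ξs z (m + 1)).toReal then
                  ∑ q : Fin (N + 1) × Fin (N + 1),
                    (incomingPairs (Torus.geometry (Fin 3)) (hsDiameter σ N)
                      (freeFlight (Torus.geometry (Fin 3))
                        (freeExitTime (Torus.geometry (Fin 3)) (hsDiameter σ N)
                          (lambertStateAfter (Torus.geometry (Fin 3)) (hsDiameter σ N) ξs z m)).toReal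
                        (lambertStateAfter (Torus.geometry (Fin 3)) (hsDiameter σ N) ξs z m))).indicator
                      (fun q' => wt q' (freeFlight (Torus.geometry (Fin 3))
                        (freeExitTime (Torus.geometry (Fin 3)) (hsDiameter σ N)
                          (lambertStateAfter (Torus.geometry (Fin 3)) (hsDiameter σ N) ξs z m)).toReal
                        (lambertStateAfter (Torus.geometry (Fin 3)) (hsDiameter σ N) ξs z m))) q
                else 0) ≤
              ∑ j ∈ Finset.range (n + 1), ∑ q : Fin (N + 1) × Fin (N + 1),
                (if q.1 ≠ q.2 ∧
                    hsDiameter σ N ≤ ‖(Torus.geometry (Fin 3)).sepVec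
                      (lambertFlow (Torus.geometry (Fin 3)) (hsDiameter σ N) ξs z (a' + (j : ℝ) * (h / ((n : ℝ) + 1))) q.1).1
                      (lambertFlow (Torus.geometry (Fin 3)) (hsDiameter σ N) ξs z (a' + (j : ℝ) * (h / ((n : ℝ) + 1))) q.2).1‖ ∧
                    ‖(Torus.geometry (Fin 3)).sepVec
                      (lambertFlow (Torus.geometry (Fin 3)) (hsDiameter σ N) ξs z (a' + (j : ℝ) * (h / ((n : ℝ) + 1))) q.1).1
                      (lambertFlow (Torus.geometry (Fin 3)) (hsDiameter σ N) ξs z (a' + (j : ℝ) * (h / ((n : ℝ) + 1))) q.2).1‖ ≤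
                      hsDiameter σ N + (h / ((n : ℝ) + 1)) *
                        ‖(lambertFlow (Torus.geometry (Fin 3)) (hsDiameter σ N) ξs z (a' + (j : ℝ) * (h / ((n : ℝ) + 1))) q.1).2 -
                          (lambertFlow (Torus.geometry (Fin 3)) (hsDiameter σ N) ξs z (a' + (j : ℝ) * (h / ((n : ℝ) + 1))) q.2).2‖
                  then wt' q (lambertFlow (Torus.geometry (Fin 3)) (hsDiameter σ N) ξs z (a' + (j : ℝ) * (h / ((n : ℝ) + 1))))
                  else 0) := by
  intro σ _ _ N z ξs _ hpos hacc hsimple wt wt' hwt0 u₀ hu₀ htrans a' h ha' hh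
  exact configMarkedContacts_le_meshSum_of_lipschitz
    (fun y s i j => LambertianContactSwapLambertianEulerFirstCollision.norm_sepVec_le_norm_sepVec_freeFlight_add
      y s i j)
    hpos hacc hsimple wt wt' hwt0 hu₀ htrans ha' hh

end Summit.AtomisticToContinuum.HydrodynamicLimit.Theorems.LambertianContactSwapLambertianEulerConfigMarkedKorolyuk

end
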